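import Literature.Probability.Percolation.IsoradialRectangularCrossingsProofs
import Literature.Probability.Percolation.QuadCrossingContinuityOfLemma51
import Literature.Probability.Percolation.QuadCrossingContinuityEventsDischarge
import HarnessLib

/-!
# DKKMO Theorem 2.1 (`q = 1`) read on quad crossings: the per-quad fact from the `d_SS` coupling

Topic `Probability/Percolation`; proofs-only sequel of `IsoradialRectangularCrossingsProofs.lean`
(no definition, no named fact). The named fact `DKKMO2020_thm21_quadCrossingProb`
(`IsoradialRectangularCrossings.lean`: Duminil-Copin–Kozlowski–Krachun–Manolescu–Oulamara,
arXiv:2012.11672v1, Theorem 2.1 at `q = 1`, read on the Schramm–Smirnov crossing event of each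
quad) is here DERIVED from the printed coupling statement of Theorem 2.1 — its Schramm–Smirnov
(`d_SS`) half, taken as the explicit hypothesis `hSS` in the metric-free rendering of the tree
(`dkkmo_theorem_1_2_schrammSmirnov`, `QuadCrossingRotationCoupling.lean`; the `𝕃(α)` version is the
named fact `DKKMO2020_thm21_schrammSmirnov` of `IsoradialRectangularCrossingsSS.lean`, whose body is
VERBATIM `hSS` below) — together with the continuity of the crossing event of a fixed quad under
critical bond percolation on `δℤ²` (Schramm–Smirnov 2011, (5.1) / Lemma 5.1, DISCHARGED in the tree:
`SchrammSmirnov2011_lemma_5_1_holds`, `Quad.continuity_of_lemma_5_1`). This is exactly how the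
paper reads its coupling theorems on crossing probabilities (§1.3; §7.1 p. 43: "the result follows
directly from [the theorem] and the measurability of `𝒞(Q)` in the Schramm–Smirnov topology"), and
the proof is the one of `dkkmo_crossing_rotation_invariance_of_schrammSmirnov`
(`QuadCrossingRotationInvarianceOfSS.lean`, DKKMO Cor. 1.3 from Thm. 1.2) with the rotated lattice
`e^{iα}δℤ²` replaced by the isoradial rectangular lattice `δ𝕃(α)` and the reference lattice `δℤ²`
by `δ𝕃(π/2) = e^{iπ/4}√2 δℤ²`:

* `openEdgeUnionEmb_eq_openEdgeRealization` — the drawn open edges of the two quad-crossing files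
  agree (`openEdgeUnionEmb z δ ω = openEdgeRealization z δ (ω ∩ E(ℤ²))`);
* `quadCrossingEmb_subset_setOf_mem_configOf` — a path crossing of `R` inside the lattice drawn
  along ANY `z` puts the quad `Q` of `R` into the Schramm–Smirnov configuration
  `configOf z δ univ (ω ∩ E)`;
* `exists_homeomorph_isoRectLinear` — for `α ∈ (0, π)` DKKMO's real-linear map `isoRectLinear α`
  (`δℤ² ↦ δ𝕃(α)`) is a homeomorphism of the plane;
* `setOf_mem_configOf_isoRectDrawing_subset_quadCrossingEmb` — conversely, up to a perturbation
  `Q < Q₁`, `Q₁ ∈ S^{α}_{ω}` forces a path crossing of `R` inside `δ𝕃(α)` (transport of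
  `joinedIn_inter_openEdgeUnion_of_isConnected` along that homeomorphism);
* `exists_isCrossing_isoRectDrawing_pi_div_two_iff` — raw crossings inside `δ𝕃(π/2)` are raw
  crossings of the quad rotated by `-π/4` inside `(√2 δ)ℤ²`, where the continuity estimate lives;
* `DKKMO2020_thm21_quadCrossingProb_of_schrammSmirnov` — **the per-quad fact from `hSS` and the
  discrete continuity (5.1)** (both error terms charged to the `𝕃(π/2)` configuration, so no
  percolation estimate on `𝕃(α)`, `α ≠ π/2`, is used);
* `DKKMO2020_thm21_quadCrossingProb_of_schrammSmirnov_of_lemma_5_1`, `…_of_schrammSmirnov'` —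
  the same with (5.1) supplied by the named fact `SchrammSmirnov2011_lemma_5_1`, resp. by its
  discharge: **`DKKMO2020_thm21_quadCrossingProb` holds as soon as the `d_SS` half of Theorem 2.1
  does.**

Written for the crux `BoxFamilyToCardy` of `CardyFormulaZ2` (stmt-CriticalPhenomena-14215), whose
known half rests on `DKKMO2020_thm21_quadCrossingProb`.

## References

* [DKKMO2020Rotational] H. Duminil-Copin, K. K. Kozlowski, D. Krachun, I. Manolescu, M. Oulamara,
  arXiv:2012.11672v1 (2020): §1.2 p. 4 (`ℋ`, `d_SS`), §2.1 p. 7 (`𝕃(α)`), Thm. 2.1 p. 7, §7.1 p. 43.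
* [SchrammSmirnov2011] O. Schramm, S. Smirnov, Ann. Probab. 39 (2011), arXiv:1101.5820, §1.3,
  §5 (Lemma 5.1, (5.1)).
-/

noncomputable section

open Set Filter Metric
open _root_.MeasureTheory _root_.Topology
open scoped ENNReal unitInterval symmDiff Real
open Literature.Probability.LatticeModels Literature.Probability.RandomPlanarGeometry

namespace Literature.Probability.Percolation

open QuadCrossing

/-! ### The drawn open edges and the Schramm–Smirnov configuration of a drawn lattice -/

/-- The two renderings of the drawn open edges agree: `openEdgeUnionEmb z δ ω` (union over the
open EDGES of `ℤ²`) is `openEdgeRealization z δ (ω ∩ E(ℤ²))` (union over the open pairs, pairs off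
the edge set removed). [folklore] -/
theorem openEdgeUnionEmb_eq_openEdgeRealization (z : Site 2 → ℂ) (δ : ℝ) (ω : BondConfig (Site 2)) :
    openEdgeUnionEmb z δ ω = openEdgeRealization z δ (ω ∩ (zdGraph 2).edgeSet) := by
  ext w
  simp only [openEdgeUnionEmb, mem_iUnion, exists_prop, openEdgeRealization, mem_setOf_eq,
    mem_inter_iff, SimpleGraph.mem_edgeSet]
  constructor
  · rintro ⟨x, y, hadj, hω, hw⟩
    exact ⟨x, y, ⟨hω, hadj⟩, hw⟩
  · rintro ⟨x, y, ⟨hω, hadj⟩, hw⟩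
    exact ⟨x, y, hadj, hω, hw⟩

/-- As a set of quads, `configOf z δ univ (ω ∩ E)` is the closure of the quads having a crossing
inside the drawn open edges `openEdgeUnionEmb z δ ω`. [cite: SchrammSmirnov2011, §1.3] -/
theorem coe_configOf_inter_edgeSet (z : Site 2 → ℂ) (δ : ℝ) (ω : BondConfig (Site 2)) :
    (configOf z δ univ (ω ∩ (zdGraph 2).edgeSet) : Set (Quad (univ : Set ℂ))) =
      closure {Q | ∃ K, Q.IsCrossing K ∧ K ⊆ openEdgeUnionEmb z δ ω} := by
  rw [openEdgeUnionEmb_eq_openEdgeRealization]; rfl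

variable {R : ConformalRectangle} {Q : Quad (univ : Set ℂ)}

/-- **A path crossing of `R` inside the lattice drawn along `z` makes the quad of `R` crossed in
`configOf z δ univ (ω ∩ E)`** (the range of the crossing path is a compact connected crossing of `Q`
inside the drawn open edges). [cite: SchrammSmirnov2011, §1.3] -/
theorem quadCrossingEmb_subset_setOf_mem_configOf (z : Site 2 → ℂ)
    (hc : Q.carrier = closure R.carrier) (h0 : Q.side 0 = R.arc 0) (h2 : Q.side 2 = R.arc 2)
    (δ : ℝ) :
    quadCrossingEmb z R δ ⊆ {ω | Q ∈ configOf z δ univ (ω ∩ (zdGraph 2).edgeSet)} := by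
  rintro ω ⟨a, ha, b, hb, γ, hγ⟩
  show Q ∈ (configOf z δ univ (ω ∩ (zdGraph 2).edgeSet) : Set (Quad (univ : Set ℂ)))
  rw [coe_configOf_inter_edgeSet]
  refine subset_closure ⟨range γ, ⟨isCompact_range γ.continuous, isConnected_range γ.continuous,
    ?_, ?_, ?_⟩, ?_⟩
  · rw [hc]; rintro _ ⟨t, rfl⟩; exact (hγ t).1
  · rw [h0]; exact ⟨a, ⟨0, γ.source⟩, ha⟩
  · rw [h2]; exact ⟨b, ⟨1, γ.target⟩, hb⟩
  · rintro _ ⟨t, rfl⟩; exact (hγ t).2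

/-- Raw crossings from membership: if `P₁ < P₂` and `P₂ ∈ configOf z δ univ (ω ∩ E)`, then `P₁` has
a crossing inside the drawn open edges. [cite: SchrammSmirnov2011, §1.3] -/
theorem exists_isCrossing_of_mem_configOf (z : Site 2 → ℂ) (δ : ℝ) {ω : BondConfig (Site 2)}
    {P₁ P₂ : Quad (univ : Set ℂ)} (hlt : P₁.StrictlyDominated P₂)
    (hmem : P₂ ∈ configOf z δ univ (ω ∩ (zdGraph 2).edgeSet)) :
    ∃ K, P₁.IsCrossing K ∧ K ⊆ openEdgeUnionEmb z δ ω := by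
  have hmem' : P₂ ∈ (configOf z δ univ (ω ∩ (zdGraph 2).edgeSet) : Set (Quad (univ : Set ℂ))) :=
    hmem
  rw [coe_configOf_inter_edgeSet] at hmem'
  exact Quad.exists_isCrossing_of_mem_closure hlt hmem'

/-- No raw crossings from non-membership: if `P₁ < Q''` and `P₁ ∉ configOf z δ univ (ω ∩ E)`, then
`Q''` has no crossing inside the drawn open edges (the configuration is a lower set containing the
raw-crossed quads). [cite: SchrammSmirnov2011, §1.3] -/
theorem not_exists_isCrossing_of_not_mem_configOf (z : Site 2 → ℂ) (δ : ℝ)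
    {ω : BondConfig (Site 2)} {P₁ Q'' : Quad (univ : Set ℂ)} (hlt : P₁.StrictlyDominated Q'')
    (hP₁ : P₁ ∉ configOf z δ univ (ω ∩ (zdGraph 2).edgeSet)) :
    ¬ ∃ K, Q''.IsCrossing K ∧ K ⊆ openEdgeUnionEmb z δ ω := by
  rintro ⟨K, hK, hKO⟩
  refine hP₁ ((configOf z δ univ (ω ∩ (zdGraph 2).edgeSet)).isLowerQuadSet ?_ hlt)
  show Q'' ∈ (configOf z δ univ (ω ∩ (zdGraph 2).edgeSet) : Set (Quad (univ : Set ℂ)))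
  rw [coe_configOf_inter_edgeSet]
  exact subset_closure ⟨K, hK, hKO⟩

/-! ### `isoRectLinear α` is a homeomorphism of the plane for `α ∈ (0, π)` -/

/-- For `α ∈ (0, π)` the real-linear map `isoRectLinear α` (carrying `δℤ²` onto `δ𝕃(α)`) is a
homeomorphism of `ℂ`: its kernel is trivial (`cos(α/2), sin(α/2) > 0`), so it is a linear
automorphism of the real plane. [cite: DKKMO2020Rotational, §2.1 p. 7] -/
theorem exists_homeomorph_isoRectLinear {α : ℝ} (hα : α ∈ Set.Ioo 0 π) :
    ∃ L : ℂ ≃ₜ ℂ, ∀ z, L z = isoRectLinear α z := by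
  have hα1 : 0 < α := hα.1
  have hα2 : α < π := hα.2
  have hcos : 0 < Real.cos (α / 2) :=
    Real.cos_pos_of_mem_Ioo ⟨by linarith [Real.pi_pos], by linarith [Real.pi_pos]⟩
  have hsin : 0 < Real.sin (α / 2) := Real.sin_pos_of_pos_of_lt_pi (by linarith)
    (by linarith [Real.pi_pos])
  have hinj : Function.Injective (isoRectLinear α : ℂ →ₗ[ℝ] ℂ) := by
    rw [← LinearMap.ker_eq_bot, LinearMap.ker_eq_bot']
    intro z hz
    have hz' : isoRectLinear α z = 0 := hz
    rw [isoRectLinear_apply, mul_eq_zero] at hz'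
    rcases hz' with h | h
    · exact absurd h (Complex.exp_ne_zero _)
    · have hre := congrArg Complex.re h
      have him := congrArg Complex.im h
      simp only [Complex.add_re, Complex.add_im, Complex.mul_re, Complex.mul_im, Complex.ofReal_re,
        Complex.ofReal_im, Complex.I_re, Complex.I_im, Complex.zero_re, Complex.zero_im] at hre him
      ring_nf at hre him
      have h1 : z.re = 0 := by
        rcases mul_eq_zero.1 (show Real.cos (α * (1 / 2)) * z.re * 2 = 0 by linarith) with h' | h'
        · rcases mul_eq_zero.1 h' with h'' | h''
          · exact absurd h'' (by rw [show α * (1/2) = α / 2 by ring]; exact hcos.ne')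
          · exact h''
        · norm_num at h'
      have h2 : z.im = 0 := by
        rcases mul_eq_zero.1 (show Real.sin (α * (1 / 2)) * z.im * 2 = 0 by linarith) with h' | h'
        · rcases mul_eq_zero.1 h' with h'' | h''
          · exact absurd h'' (by rw [show α * (1/2) = α / 2 by ring]; exact hsin.ne')
          · exact h''
        · norm_num at h'
      exact Complex.ext h1 h2
  have hbij : Function.Bijective (isoRectLinear α : ℂ →ₗ[ℝ] ℂ) :=
    ⟨hinj, (LinearMap.injective_iff_surjective).1 hinj⟩
  refine ⟨(LinearEquiv.ofBijective _ hbij).toContinuousLinearEquiv.toHomeomorph, fun z => rfl⟩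

/-- **The converse inclusion, up to a perturbation, for the lattice `δ𝕃(α)`**: if `Q < Q₁` in
Schramm–Smirnov's order and `Q₁ ∈ S^{α}_{ω}` (`configOf` of `ω` drawn on `δ𝕃(α)`, `α ∈ (0, π)`,
`δ > 0`), then `ω` drawn on `δ𝕃(α)` crosses `R` by an open path: the connected compact crossing of
`Q` inside the drawn open edges (`Quad.exists_isCrossing_of_mem_closure`) is pulled back to `δℤ²`
by the homeomorphism `isoRectLinear α`, made a path crossing there
(`joinedIn_inter_openEdgeUnion_of_isConnected`), and pushed forward again.
[cite: SchrammSmirnov2011, §1.3] -/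
theorem setOf_mem_configOf_isoRectDrawing_subset_quadCrossingEmb {α : ℝ} (hα : α ∈ Set.Ioo 0 π)
    (hc : Q.carrier = closure R.carrier) (h0 : Q.side 0 = R.arc 0) (h2 : Q.side 2 = R.arc 2)
    {Q₁ : Quad (univ : Set ℂ)} (hQ : Q.StrictlyDominated Q₁) {δ : ℝ} (hδ : 0 < δ) :
    {ω | Q₁ ∈ configOf (isoRectDrawing α) δ univ (ω ∩ (zdGraph 2).edgeSet)} ⊆
      quadCrossingEmb (isoRectDrawing α) R δ := by
  intro ω hω
  obtain ⟨K, ⟨hKc, hKconn, hKQ, ⟨a, haK, ha⟩, ⟨b, hbK, hb⟩⟩, hKO⟩ :=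
    exists_isCrossing_of_mem_configOf (isoRectDrawing α) δ hQ hω
  obtain ⟨L, hL⟩ := exists_homeomorph_isoRectLinear hα
  have hLfun : (isoRectLinear α : ℂ → ℂ) = L := funext fun z => (hL z).symm
  have hU : openEdgeUnionEmb (isoRectDrawing α) δ ω = L '' openEdgeUnion δ ω := by
    rw [openEdgeUnionEmb_isoRectDrawing_eq_image, hLfun]
  -- pull the crossing back to `δℤ²`
  set K' : Set ℂ := L.symm '' K with hK'
  have hK'c : IsCompact K' := hKc.image L.symm.continuous
  have hK'conn : IsConnected K' := hKconn.image _ L.symm.continuous.continuousOn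
  have hK'O : K' ⊆ openEdgeUnion δ ω := by
    rintro _ ⟨k, hk, rfl⟩
    obtain ⟨u, hu, hku⟩ := (hU ▸ hKO hk : k ∈ L '' openEdgeUnion δ ω)
    rw [← hku, Homeomorph.symm_apply_apply]
    exact hu
  have hK'C : K' ⊆ L.symm '' closure R.carrier := image_mono (hc ▸ hKQ)
  have hj := joinedIn_inter_openEdgeUnion_of_isConnected hδ hK'c hK'conn hK'O hK'C
    (mem_image_of_mem L.symm haK) (mem_image_of_mem L.symm hbK)
  -- push the path forward again
  have hj' := hj.map L.continuous
  have himg : L '' (L.symm '' closure R.carrier) = closure R.carrier := by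
    rw [Set.image_image]; simp only [Homeomorph.apply_symm_apply, image_id']
  rw [Homeomorph.apply_symm_apply, Homeomorph.apply_symm_apply, image_inter L.injective, himg,
    ← hU] at hj'
  exact ⟨a, h0 ▸ ha, b, h2 ▸ hb, hj'⟩

/-! ### The reference lattice `δ𝕃(π/2) = e^{iπ/4} √2 δℤ²` -/

/-- **Raw crossings inside `δ𝕃(π/2)` are raw crossings inside `(√2 δ)ℤ²` of the quad rotated by
`-π/4`** (`openEdgeUnionEmb_isoRectDrawing_pi_div_two`: the drawn open edges of `δ𝕃(π/2)` are the
`π/4`-rotation of those of `(√2 δ)ℤ²`; crossings are carried by the rotation and back).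
[cite: DKKMO2020Rotational, §2.1 p. 7] -/
theorem exists_isCrossing_isoRectDrawing_pi_div_two_iff (P : Quad (univ : Set ℂ)) (δ : ℝ)
    (ω : BondConfig (Site 2)) :
    (∃ K, P.IsCrossing K ∧ K ⊆ openEdgeUnionEmb (isoRectDrawing (π / 2)) δ ω) ↔
      ∃ K, (P.mapHomeomorph (rotation (Circle.exp (π / 4))).toHomeomorph.symm).IsCrossing K ∧
        K ⊆ openEdgeUnion (Real.sqrt 2 * δ) ω := by
  set ρ : ℂ ≃ₜ ℂ := (rotation (Circle.exp (π / 4))).toHomeomorph with hρ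
  rw [openEdgeUnionEmb_isoRectDrawing_pi_div_two]
  constructor
  · rintro ⟨K, hK, hKO⟩
    refine ⟨ρ.symm '' K, hK.image ρ.symm, ?_⟩
    rintro _ ⟨k, hk, rfl⟩
    obtain ⟨u, hu, hku⟩ := hKO hk
    rw [← hku, Homeomorph.symm_apply_apply]
    exact hu
  · rintro ⟨K, hK, hKO⟩
    refine ⟨ρ '' K, ?_, image_mono hKO⟩
    simpa only [Quad.mapHomeomorph_mapHomeomorph_symm] using hK.image ρ

/-! ### The per-quad fact from the Schramm–Smirnov half of Theorem 2.1 and the continuity (5.1) -/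

/-- **`DKKMO2020_thm21_quadCrossingProb` from the `d_SS` half of DKKMO's Theorem 2.1 and the
continuity of crossing events** (arXiv:2012.11672v1, Thm. 2.1, read per quad as in §7.1 p. 43:
"the result follows directly from [the theorem] and the measurability of `𝒞(Q)` in the
Schramm–Smirnov topology"), with its two inputs as explicit hypotheses (no named fact is introduced):

* `hSS` — Theorem 2.1, `d_SS` part, `q = 1`, rendered metric-free on the tree's Schramm–Smirnov
  space `ℋ_ℂ = QuadConfig univ` (VERBATIM the body of the named fact
  `DKKMO2020_thm21_schrammSmirnov` of `IsoradialRectangularCrossingsSS.lean`): for every `ε > 0` and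
  every open neighbourhood `N` of the diagonal of `ℋ_ℂ × ℋ_ℂ` there is `δ₀ > 0` such that for all
  `α ∈ (ε, π - ε)`, `0 < δ ≤ δ₀` some coupling `ℙ` of `φ_{δ𝕃(α)} = prodBernoulli (isoRectCriticalProb α)`
  and `φ_{δ𝕃(π/2)}` has `ℙ[(S^{α}_{ω}, S^{π/2}_{ω'}) ∉ N] < ε`, where
  `S^{β}_{ω} = configOf (isoRectDrawing β) δ univ (ω ∩ E)` is `ω` drawn on `δ𝕃(β)` seen in `ℋ_ℂ`;
* `hcont` — the discrete continuity (5.1) of Schramm–Smirnov for critical bond percolation on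
  `δℤ²`: for every quad `Q₀ ∈ 𝒬_ℂ` and `ε > 0` there are `Q' < Q₀ < Q''` and `δ₀ > 0` with
  `P_{1/2}[Q' crossed inside the open edges of δℤ² ∧ Q'' not] ≤ ε` for `0 < δ < δ₀` — literally the
  hypothesis of `SchrammSmirnov2011_lemma_5_1_of_continuity` at `D = univ`, supplied by
  `Quad.continuity_of_lemma_5_1`.

Proof (that of `dkkmo_crossing_rotation_invariance_of_schrammSmirnov`, with the reference
configuration on `δ𝕃(π/2)`). Fix `R`, `ε`; let `Q ∈ 𝒬_ℂ` be the quad of `R` (square model) and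
`Q₀ = e^{-iπ/4}∘Q` its picture for `(√2 δ)ℤ²`; take `Q'₀ < Q₀ < Q''₀` and `δ_c` from `hcont` at
`ε/3`, rotate them back (`Q' < Q < Q''`), and choose `Q' < Qm < Q < Q₁ < Q₂ < Q''`. In `ℋ_ℂ` let
`N = {(S, S') : (S ∈ closure V^{Q₁} → S' ∈ V^{Q₂}) ∧ (S ∈ ⊞_Q → S' ∈ V_U)}`, `U = {Qm < · < Q₁}`, an
open neighbourhood of the diagonal. Under the coupling of `hSS` at `(ε/3, N)`: if `ω` crosses `R` on
`δ𝕃(α)` but `ω'` does not on `δ𝕃(π/2)`, then `Q ∈ S^{α}_{ω}` and `Q₁ ∉ S^{π/2}_{ω'}`, so on `N`,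
`Qm ∈ S^{π/2}_{ω'}`; if `ω'` crosses but `ω` does not, then `Q ∈ S^{π/2}_{ω'}` and `Q₁ ∉ S^{α}_{ω}`,
so on `N`, `Q₂ ∉ S^{π/2}_{ω'}`. In both cases `ω'` lies in `E = {Q'₀ raw-crossed ∧ Q''₀ not}` inside
`(√2 δ)ℤ²` (`exists_isCrossing_isoRectDrawing_pi_div_two_iff`), an event of the `𝕃(π/2)` marginal
`= P_{1/2}` (`prodBernoulli_isoRectCriticalProb_pi_div_two`) of probability `≤ ε/3` once
`√2 δ < δ_c`; with `ℙ[∉ N] < ε/3` the crossing indicators disagree with probability `≤ ε`, uniformly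
in `α ∈ (ε, π - ε)` and `δ < min δ₀ (δ_c/2)`, and `DKKMO2020_thm21_quadCrossingProb_of_coupling`
concludes. No percolation estimate on `𝕃(α)`, `α ≠ π/2`, is used.
[cite: DKKMO2020Rotational, Thm. 2.1 (q = 1), with §7.1 p. 43] -/
theorem DKKMO2020_thm21_quadCrossingProb_of_schrammSmirnov
    (hSS : ∀ ε : ℝ, 0 < ε →
      ∀ N : Set (QuadConfig (univ : Set ℂ) × QuadConfig (univ : Set ℂ)), IsOpen N →
        (∀ S, (S, S) ∈ N) →
        ∃ δ₀ : ℝ, 0 < δ₀ ∧ ∀ α ∈ Set.Ioo ε (π - ε), ∀ δ : ℝ, 0 < δ → δ ≤ δ₀ →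
          ∃ P : Measure (BondConfig (Site 2) × BondConfig (Site 2)),
            P.map Prod.fst = prodBernoulli (isoRectCriticalProb α) ∧
            P.map Prod.snd = prodBernoulli (isoRectCriticalProb (π / 2)) ∧
            P {p | (configOf (isoRectDrawing α) δ univ (p.1 ∩ (zdGraph 2).edgeSet),
              configOf (isoRectDrawing (π / 2)) δ univ (p.2 ∩ (zdGraph 2).edgeSet)) ∉ N} <
              ENNReal.ofReal ε)
    (hcont : ∀ (Q₀ : Quad (univ : Set ℂ)) (ε : ℝ≥0∞), 0 < ε →
      ∃ Q' Q'' : Quad (univ : Set ℂ), Quad.StrictlyDominated Q' Q₀ ∧ Quad.StrictlyDominated Q₀ Q'' ∧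
        ∃ δ₀ : ℝ, 0 < δ₀ ∧ ∀ δ : ℝ, 0 < δ → δ < δ₀ →
          bondPercolation (zdGraph 2) half
            {ω | (∃ K, Q'.IsCrossing K ∧ K ⊆ openEdgeUnion δ ω) ∧
              ¬ ∃ K, Q''.IsCrossing K ∧ K ⊆ openEdgeUnion δ ω} ≤ ε) :
    DKKMO2020_thm21_quadCrossingProb := by
  refine DKKMO2020_thm21_quadCrossingProb_of_coupling fun R ε hε => ?_
  -- the quad of `R` and its picture for `(√2 δ)ℤ²`
  obtain ⟨Φ, hΦ⟩ := exists_isSquareModel R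
  have hc : (squareModelQuad Φ).carrier = closure R.carrier := hΦ.carrier_squareModelQuad
  have h0 : (squareModelQuad Φ).side 0 = R.arc 0 := hΦ.side_zero_squareModelQuad
  have h2 : (squareModelQuad Φ).side 2 = R.arc 2 := hΦ.side_two_squareModelQuad
  set Q : Quad (univ : Set ℂ) := squareModelQuad Φ
  set ρ : ℂ ≃ₜ ℂ := (rotation (Circle.exp (π / 4))).toHomeomorph with hρ
  set Q₀ : Quad (univ : Set ℂ) := Q.mapHomeomorph ρ.symm with hQ₀
  -- continuity at `Q₀`, with `ε/3`
  have hε3 : 0 < ε / 3 := by positivity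
  obtain ⟨Q'₀, Q''₀, hQ'Q₀, hQ₀Q'', δc, hδc, hE⟩ :=
    hcont Q₀ (ENNReal.ofReal (ε / 3)) (ENNReal.ofReal_pos.2 hε3)
  -- rotate the perturbations back: `Q' < Q < Q''`
  set Q' : Quad (univ : Set ℂ) := Q'₀.mapHomeomorph ρ with hQ'
  set Q'' : Quad (univ : Set ℂ) := Q''₀.mapHomeomorph ρ with hQ''
  have hQ'Q : Quad.StrictlyDominated Q' Q := by
    simpa only [hQ₀, Quad.mapHomeomorph_mapHomeomorph_symm] using hQ'Q₀.mapHomeomorph ρ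
  have hQQ'' : Quad.StrictlyDominated Q Q'' := by
    simpa only [hQ₀, Quad.mapHomeomorph_mapHomeomorph_symm] using hQ₀Q''.mapHomeomorph ρ
  have hQ'symm : Q'.mapHomeomorph ρ.symm = Q'₀ := Quad.mapHomeomorph_symm_mapHomeomorph ρ Q'₀
  have hQ''symm : Q''.mapHomeomorph ρ.symm = Q''₀ := Quad.mapHomeomorph_symm_mapHomeomorph ρ Q''₀
  -- intermediate quads `Q' < Qm < Q < Q₁ < Q₂ < Q''`
  obtain ⟨Qm, hQ'Qm, hQmQ⟩ := Quad.exists_strictlyDominated_between isOpen_univ hQ'Q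
  obtain ⟨Q₁, hQQ₁, hQ₁Q''⟩ := Quad.exists_strictlyDominated_between isOpen_univ hQQ''
  obtain ⟨Q₂, hQ₁Q₂, hQ₂Q''⟩ := Quad.exists_strictlyDominated_between isOpen_univ hQ₁Q''
  -- the sets of the neighbourhood of the diagonal
  have hU : IsOpen {P : Quad (univ : Set ℂ) | Quad.StrictlyDominated Qm P ∧ Quad.StrictlyDominated P Q₁} :=
    (Quad.isOpen_setOf_strictlyDominated_right Qm).inter (Quad.isOpen_setOf_strictlyDominated_left Q₁)
  have hK₁O₁ : closure (QuadConfig.notCrossed Q₁) ⊆ QuadConfig.notCrossed Q₂ :=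
    QuadConfig.closure_notCrossed_subset isOpen_univ hQ₁Q₂
  have hK₂O₂ : QuadConfig.crossedEvent Q ⊆
      QuadConfig.someCrossed {P | Quad.StrictlyDominated Qm P ∧ Quad.StrictlyDominated P Q₁} := by
    intro S hS
    obtain ⟨P, ⟨hQmP, hPQ₁⟩, hPQ⟩ := mem_closure_iff.mp
      (Quad.mem_closure_setOf_strictlyDominated isOpen_univ Q) _ hU ⟨hQmQ, hQQ₁⟩
    exact ⟨P, S.isLowerQuadSet hS hPQ, hQmP, hPQ₁⟩
  have hO₂sub : QuadConfig.someCrossed {P | Quad.StrictlyDominated Qm P ∧ Quad.StrictlyDominated P Q₁} ⊆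
      QuadConfig.crossedEvent Qm := fun S ⟨P, hPS, hQmP, _⟩ => S.isLowerQuadSet hPS hQmP
  -- the neighbourhood `N` (information flows from the first = `𝕃(α)` coordinate to the second)
  obtain ⟨N, hNopen, hNdiag, hN₁, hN₂⟩ : ∃ N : Set (QuadConfig (univ : Set ℂ) ×
      QuadConfig (univ : Set ℂ)), IsOpen N ∧ (∀ S, (S, S) ∈ N) ∧
      (∀ p ∈ N, p.1 ∈ closure (QuadConfig.notCrossed Q₁) → p.2 ∈ QuadConfig.notCrossed Q₂) ∧
      (∀ p ∈ N, p.1 ∈ QuadConfig.crossedEvent Q →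
        p.2 ∈ QuadConfig.someCrossed {P | Quad.StrictlyDominated Qm P ∧ Quad.StrictlyDominated P Q₁}) := by
    refine ⟨(((closure (QuadConfig.notCrossed Q₁))ᶜ ×ˢ univ) ∪ (univ ×ˢ QuadConfig.notCrossed Q₂)) ∩
      (((QuadConfig.crossedEvent Q)ᶜ ×ˢ univ) ∪
        (univ ×ˢ QuadConfig.someCrossed {P | Quad.StrictlyDominated Qm P ∧ Quad.StrictlyDominated P Q₁})),
      ?_, fun S => ⟨?_, ?_⟩, ?_, ?_⟩
    · exact ((isClosed_closure.isOpen_compl.prod isOpen_univ).union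
        (isOpen_univ.prod (QuadConfig.isOpen_notCrossed Q₂))).inter
        (((QuadConfig.isClosed_crossedEvent Q).isOpen_compl.prod isOpen_univ).union
          (isOpen_univ.prod (QuadConfig.isOpen_someCrossed hU)))
    · by_cases hS : S ∈ closure (QuadConfig.notCrossed Q₁)
      · exact Or.inr ⟨mem_univ _, hK₁O₁ hS⟩
      · exact Or.inl ⟨hS, mem_univ _⟩
    · by_cases hS : S ∈ QuadConfig.crossedEvent Q
      · exact Or.inr ⟨mem_univ _, hK₂O₂ hS⟩
      · exact Or.inl ⟨hS, mem_univ _⟩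
    · rintro p ⟨hp, -⟩ hp1
      rcases hp with ⟨hp', -⟩ | ⟨-, hp'⟩
      · exact absurd hp1 hp'
      · exact hp'
    · rintro p ⟨-, hp⟩ hp1
      rcases hp with ⟨hp', -⟩ | ⟨-, hp'⟩
      · exact absurd hp1 hp'
      · exact hp'
  -- the coupling from the Schramm–Smirnov half of Theorem 2.1, with `ε/3`
  obtain ⟨δs, hδs, hcoup⟩ := hSS (ε / 3) hε3 N hNopen hNdiag
  have hδc2 : 0 < δc / 2 := by positivity
  refine ⟨min δs (δc / 2), lt_min hδs hδc2, fun α hα δ hδ => ?_⟩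
  have hα' : α ∈ Set.Ioo (ε / 3) (π - ε / 3) := ⟨by linarith [hα.1], by linarith [hα.2]⟩
  have hα0 : α ∈ Set.Ioo 0 π := ⟨hε.trans hα.1, by linarith [hα.2]⟩
  have hπ2 : π / 2 ∈ Set.Ioo 0 π := ⟨by positivity, by linarith [Real.pi_pos]⟩
  obtain ⟨P, hP1, hP2, hPN⟩ := hcoup α hα' δ hδ.1 (hδ.2.le.trans (min_le_left _ _))
  refine ⟨P, hP1, hP2, ?_⟩
  haveI : IsProbabilityMeasure P := isProbabilityMeasure_of_map_fst hP1
  -- the mesh of the reference picture: `√2 δ < δ_c`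
  have hδ' : 0 < Real.sqrt 2 * δ := by have := hδ.1; positivity
  have hδ'c : Real.sqrt 2 * δ < δc := by
    have h2 : Real.sqrt 2 < 2 := by
      rw [show (2 : ℝ) = Real.sqrt 4 by rw [show (4 : ℝ) = 2 ^ 2 by norm_num, Real.sqrt_sq (by norm_num : (0:ℝ) ≤ 2)]]
      exact Real.sqrt_lt_sqrt (by norm_num) (by norm_num)
    have hδ2 : δ < δc / 2 := hδ.2.trans_le (min_le_right _ _)
    nlinarith [hδ.1]
  -- notation for the two Schramm–Smirnov configurations
  set Sα : BondConfig (Site 2) → QuadConfig (univ : Set ℂ) :=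
    fun ω => configOf (isoRectDrawing α) δ univ (ω ∩ (zdGraph 2).edgeSet) with hSα
  set Sr : BondConfig (Site 2) → QuadConfig (univ : Set ℂ) :=
    fun ω => configOf (isoRectDrawing (π / 2)) δ univ (ω ∩ (zdGraph 2).edgeSet) with hSr
  -- the reference error event, inside `(√2 δ)ℤ²`
  set E : Set (BondConfig (Site 2)) :=
    {ω | (∃ K, Q'₀.IsCrossing K ∧ K ⊆ openEdgeUnion (Real.sqrt 2 * δ) ω) ∧
      ¬ ∃ K, Q''₀.IsCrossing K ∧ K ⊆ openEdgeUnion (Real.sqrt 2 * δ) ω} with hEdef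
  -- plane raw crossings of `Q'`, `Q''` inside `δ𝕃(π/2)` are the axis ones of `Q'₀`, `Q''₀`
  have hrawQ' : ∀ {ω' : BondConfig (Site 2)},
      (∃ K, Q'.IsCrossing K ∧ K ⊆ openEdgeUnionEmb (isoRectDrawing (π / 2)) δ ω') →
        ∃ K, Q'₀.IsCrossing K ∧ K ⊆ openEdgeUnion (Real.sqrt 2 * δ) ω' := fun {ω'} h => by
    have := (exists_isCrossing_isoRectDrawing_pi_div_two_iff Q' δ ω').1 h
    rwa [hQ'symm] at this
  have hrawQ'' : ∀ {ω' : BondConfig (Site 2)},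
      (¬ ∃ K, Q''.IsCrossing K ∧ K ⊆ openEdgeUnionEmb (isoRectDrawing (π / 2)) δ ω') →
        ¬ ∃ K, Q''₀.IsCrossing K ∧ K ⊆ openEdgeUnion (Real.sqrt 2 * δ) ω' := fun {ω'} h h' => by
    refine h ((exists_isCrossing_isoRectDrawing_pi_div_two_iff Q'' δ ω').2 ?_)
    rwa [hQ''symm]
  -- the inclusion of events: the difference is charged to `E` on the reference coordinate, or off `N`
  have hincl : (Prod.fst ⁻¹' quadCrossingEmb (isoRectDrawing α) R δ) ∆
      (Prod.snd ⁻¹' quadCrossingEmb (isoRectDrawing (π / 2)) R δ) ⊆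
      Prod.snd ⁻¹' E ∪ {p | (Sα p.1, Sr p.2) ∉ N} := by
    rintro ⟨ω, ω'⟩ hp
    by_cases hbad : (Sα ω, Sr ω') ∈ N
    swap
    · exact Or.inr hbad
    left
    rcases hp with ⟨hA, hB⟩ | ⟨hB, hA⟩
    · -- `ω` crosses on `δ𝕃(α)`, `ω'` does not on `δ𝕃(π/2)`: `Q ∈ Sα`, `Q₁ ∉ Sr`, so `Qm ∈ Sr`
      have hS : Q ∈ Sα ω := quadCrossingEmb_subset_setOf_mem_configOf _ hc h0 h2 δ hA
      have hS' : Q₁ ∉ Sr ω' := fun hmem =>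
        hB (setOf_mem_configOf_isoRectDrawing_subset_quadCrossingEmb hπ2 hc h0 h2 hQQ₁ hδ.1 hmem)
      have hO : Sr ω' ∈ QuadConfig.crossedEvent Qm := hO₂sub (hN₂ _ hbad hS)
      exact ⟨hrawQ' (exists_isCrossing_of_mem_configOf _ δ hQ'Qm hO),
        hrawQ'' (not_exists_isCrossing_of_not_mem_configOf _ δ hQ₁Q'' hS')⟩
    · -- `ω'` crosses on `δ𝕃(π/2)`, `ω` does not on `δ𝕃(α)`: `Q ∈ Sr`, `Q₁ ∉ Sα`, so `Q₂ ∉ Sr`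
      have hS' : Q ∈ Sr ω' := quadCrossingEmb_subset_setOf_mem_configOf _ hc h0 h2 δ hB
      have hS : Q₁ ∉ Sα ω := fun hmem =>
        hA (setOf_mem_configOf_isoRectDrawing_subset_quadCrossingEmb hα0 hc h0 h2 hQQ₁ hδ.1 hmem)
      have hO : Sr ω' ∈ QuadConfig.notCrossed Q₂ := hN₁ _ hbad (subset_closure hS)
      exact ⟨hrawQ' (exists_isCrossing_of_mem_configOf _ δ hQ'Q hS'),
        hrawQ'' (not_exists_isCrossing_of_not_mem_configOf _ δ hQ₂Q'' hO)⟩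
  -- measure bounds
  have hPE : P.real (Prod.snd ⁻¹' E) ≤ ε / 3 := by
    refine (measureReal_preimage_snd_le_of_map_eq hP2 _).trans ?_
    rw [prodBernoulli_isoRectCriticalProb_pi_div_two]
    exact ENNReal.toReal_le_of_le_ofReal hε3.le (hE _ hδ' hδ'c)
  have hPBad : P.real {p | (Sα p.1, Sr p.2) ∉ N} < ε / 3 := ENNReal.toReal_lt_of_lt_ofReal hPN
  calc P.real ((Prod.fst ⁻¹' quadCrossingEmb (isoRectDrawing α) R δ) ∆
        (Prod.snd ⁻¹' quadCrossingEmb (isoRectDrawing (π / 2)) R δ))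
      ≤ _ := measureReal_mono hincl
    _ ≤ _ := measureReal_union_le _ _
    _ ≤ ε := by linarith

/-- **The per-quad fact from the `d_SS` half of Theorem 2.1 and Schramm–Smirnov's Lemma 5.1** (the
continuity input `hcont` of `DKKMO2020_thm21_quadCrossingProb_of_schrammSmirnov` supplied by
`Quad.continuity_of_lemma_5_1`). [cite: DKKMO2020Rotational, Thm. 2.1 (q = 1), with §7.1 p. 43] -/
theorem DKKMO2020_thm21_quadCrossingProb_of_schrammSmirnov_of_lemma_5_1
    (hSS : ∀ ε : ℝ, 0 < ε →
      ∀ N : Set (QuadConfig (univ : Set ℂ) × QuadConfig (univ : Set ℂ)), IsOpen N →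
        (∀ S, (S, S) ∈ N) →
        ∃ δ₀ : ℝ, 0 < δ₀ ∧ ∀ α ∈ Set.Ioo ε (π - ε), ∀ δ : ℝ, 0 < δ → δ ≤ δ₀ →
          ∃ P : Measure (BondConfig (Site 2) × BondConfig (Site 2)),
            P.map Prod.fst = prodBernoulli (isoRectCriticalProb α) ∧
            P.map Prod.snd = prodBernoulli (isoRectCriticalProb (π / 2)) ∧
            P {p | (configOf (isoRectDrawing α) δ univ (p.1 ∩ (zdGraph 2).edgeSet),
              configOf (isoRectDrawing (π / 2)) δ univ (p.2 ∩ (zdGraph 2).edgeSet)) ∉ N} <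
              ENNReal.ofReal ε)
    (h51 : SchrammSmirnov2011_lemma_5_1) :
    DKKMO2020_thm21_quadCrossingProb :=
  DKKMO2020_thm21_quadCrossingProb_of_schrammSmirnov hSS
    fun Q₀ ε hε => Quad.continuity_of_lemma_5_1 h51 Q₀ ε hε

/-- **`DKKMO2020_thm21_quadCrossingProb` holds as soon as the `d_SS` half of DKKMO's Theorem 2.1
does**: Schramm–Smirnov's Lemma 5.1 is discharged in the tree (`SchrammSmirnov2011_lemma_5_1_holds`),
so the only remaining input is `hSS` (= the named fact `DKKMO2020_thm21_schrammSmirnov`).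
[cite: DKKMO2020Rotational, Thm. 2.1 (q = 1), with §7.1 p. 43] -/
theorem DKKMO2020_thm21_quadCrossingProb_of_schrammSmirnov'
    (hSS : ∀ ε : ℝ, 0 < ε →
      ∀ N : Set (QuadConfig (univ : Set ℂ) × QuadConfig (univ : Set ℂ)), IsOpen N →
        (∀ S, (S, S) ∈ N) →
        ∃ δ₀ : ℝ, 0 < δ₀ ∧ ∀ α ∈ Set.Ioo ε (π - ε), ∀ δ : ℝ, 0 < δ → δ ≤ δ₀ →
          ∃ P : Measure (BondConfig (Site 2) × BondConfig (Site 2)),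
            P.map Prod.fst = prodBernoulli (isoRectCriticalProb α) ∧
            P.map Prod.snd = prodBernoulli (isoRectCriticalProb (π / 2)) ∧
            P {p | (configOf (isoRectDrawing α) δ univ (p.1 ∩ (zdGraph 2).edgeSet),
              configOf (isoRectDrawing (π / 2)) δ univ (p.2 ∩ (zdGraph 2).edgeSet)) ∉ N} <
              ENNReal.ofReal ε) :
    DKKMO2020_thm21_quadCrossingProb :=
  DKKMO2020_thm21_quadCrossingProb_of_schrammSmirnov_of_lemma_5_1 hSS
    QuadCrossing.SchrammSmirnov2011_lemma_5_1_holds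

end Literature.Probability.Percolation

end
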